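import Summits.BirchSwinnertonDyer.BirchSwinnertonDyer.Theses.PrintX9
import Literature.NumberTheory.EllipticCurves.LambdaAdicSelmerDataTorsionFreeProofs
import Literature.NumberTheory.EllipticCurves.HeegnerCharIdealScalingTransferProofs
import Literature.NumberTheory.EllipticCurves.HeegnerCharIdealEnvelopePowTransferProofs
import Literature.NumberTheory.EllipticCurves.IwasawaSelmerDualProofs
import HarnessLib

/-!
# The row-9/row-10 binder `PrintX9.CGLSHeegnerClassNonvanishing` (stmt-BirchSwinnertonDyer-27103) REDUCES to
# Cornut–Vatsal non-vanishing given the CGS binder: conjunct 1 (torsion-freeness of `𝔖`) is a KERNEL THEOREM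
# (p645741) and conjunct 3 (`𝔖/Λκ_∞(C)` torsion) follows from rank one (binder `CGSHowardDivisibilityPLocalized`)
# — a trust-base note for the deciding cruxes `HowardContainmentLightFramePinnedOfPrintSharp` (X9, 27077) and its X10b twin

Cell `pub/bsd-print-x9`, seat `bsd-line-x9-p2` (g3); `--supports` stmt-BirchSwinnertonDyer-27077. THEOREMS ONLY; no
definition, no named fact, no `sorry`. The cite-only binder `CGLSHeegnerClassNonvanishing` (= the Literature fact
`CastellaGrossiLeeSkinner2022.thm411_torsionFree_heegnerClass_ne_bot_quotient_isTorsion`, universe 0) records, under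
`Thm413Hypotheses`, for every pin `D` and stabilised datum `C`:
  (1) `NoZeroSMulDivisors Λ D.S` ∧ (2) `stabilizedHeegnerModule D C ≠ ⊥` ∧ (3) `Module.IsTorsion Λ (D.S ⧸ stabilizedHeegnerModule D C)`.
* (1) is now PROVED for every pin from `E(K)[p] = 0` + a topological generator
  (`LambdaAdicSelmerData.noZeroSMulDivisors_of_noPTorsion`, file `LambdaAdicSelmerDataTorsionFreeProofs`);
* (3) follows from (1), (2) and `finrank_Λ 𝔖 = 1` — the first clause of the crux's OTHER binder
  `CGSHowardDivisibilityPLocalized` (CGS25 Thm. 6.5.2) — by rank–nullity over the domain `Λ`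
  (`Module.isTorsion_quotient_span_singleton_of_torsionFree_of_finrank_eq_one` + torsion transfer);
* (2) is Cornut–Vatsal's non-vanishing of the stabilised Heegner classes (through CGLS22 Thm. 4.1.1 / Rem. 4.1.4),
  the ONLY part of the binder not in the kernel.
WHAT. `cglsHeegnerClassNonvanishing_of_cgs_of_forall_ne_bot : CGSHowardDivisibilityPLocalized → (∀ frame D C,
Thm413Hypotheses … → stabilizedHeegnerModule D C ≠ ⊥) → CGLSHeegnerClassNonvanishing`, and the frame-level form
`noZeroSMulDivisors_ne_bot_isTorsion_of_finrank_eq_one` (one frame: `E(K)[p] = 0`, `γ` top. generator, `𝔖` f.g. of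
`finrank 1`, `Λκ_∞(C) ≠ ⊥` ⟹ the three conjuncts). USE (planner / referee): the binder item 27103 may be slimmed to
its Cornut–Vatsal conjunct without changing any consumer (this theorem rebuilds the whole value from the slim one +
27112); nothing here changes the route (W-71). HONEST FRAMING: conditional bookkeeping; Cornut–Vatsal is NOT proved
here; BSD is not proved by any of this; no summit statement is proved by this seat.

References: [CastellaGrossiLeeSkinner2022] Thm. 4.1.1, Rem. 4.1.4, §3.3; [CastellaGrossiSkinner2025] Thm. 6.5.2;
[PerrinRiou1987BSMF] §1 p. 405 (rank one ⟺ torsion quotient); [Howard2004HeegnerKolyvagin] Thm. 3.3.7 (Cornut–Vatsal input).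
-/

set_option linter.dupNamespace false
set_option autoImplicit false

noncomputable section

open scoped Classical Pointwise

open Literature Literature.NumberTheory.EllipticCurves WeierstrassCurve
open Summit.BirchSwinnertonDyer.BirchSwinnertonDyer.Theses.PrintX9

namespace Summit.BirchSwinnertonDyer.BirchSwinnertonDyer.Theorems.PrintX9Binders

/-- **One frame: torsion-freeness, non-vanishing and torsion quotient from rank one.** For an elliptic curve
`V/K` with `E(K)[p] = 0`, a `ℤ_p`-extension with topological generator `γ`, a pin `D` of `𝔖_p(K_∞)` which is
finitely generated of `finrank 1`, and a submodule `L ≠ ⊥` (e.g. `Λκ_∞(C)`): `𝔖` has no `Λ`-torsion (p645741) and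
`𝔖 ⧸ L` is `Λ`-torsion (rank–nullity over the domain `Λ`).
[cite: PerrinRiou1987BSMF, §1 p. 405 (I(H_∞) ≠ 0 iff H_∞ and 𝔖_p have the same rank 1)]
[cite: CastellaGrossiLeeSkinner2022, §3.3 (torsion-freeness) and Thm. 4.1.3 (i) (rank one)] -/
theorem noZeroSMulDivisors_and_isTorsion_quotient_of_finrank_eq_one {K : Type} [Field K] [NumberField K]
    {V : WeierstrassCurve K} [V.IsElliptic] {p : ℕ} [Fact p.Prime] {κ : ZpExtension K p}
    {γ : Field.absoluteGaloisGroup K} (D : V.LambdaAdicSelmerData κ γ) (hγ : κ.IsTopGenerator γ)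
    (hE : ∀ P : V.toAffine.Point, p • P = 0 → P = 0) [Module.Finite (IwasawaAlgebra p) D.S]
    (h1 : Module.finrank (IwasawaAlgebra p) D.S = 1) {L : Submodule (IwasawaAlgebra p) D.S} (hL : L ≠ ⊥) :
    NoZeroSMulDivisors (IwasawaAlgebra p) D.S ∧ Module.IsTorsion (IwasawaAlgebra p) (D.S ⧸ L) := by
  haveI := D.noZeroSMulDivisors_of_noPTorsion hγ hE
  refine ⟨inferInstance, ?_⟩
  obtain ⟨z, hzL, hz0⟩ := (Submodule.ne_bot_iff L).mp hL
  have hz : ∀ b : IwasawaAlgebra p, b • z = 0 → b = 0 := fun b hb ↦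
    by_contra fun hb0 ↦ D.forall_smul_ne_zero_of_ne_zero' hγ hE hz0 b hb0 hb
  have htor := Module.isTorsion_quotient_span_singleton_of_torsionFree_of_finrank_eq_one (p := p) h1 hz
  refine Module.isTorsion_quotient_of_isTorsion_quotient_of_smul_le htor (one_ne_zero (α := IwasawaAlgebra p)) ?_
  rw [one_smul]
  exact (Submodule.span_singleton_le_iff_mem z L).mpr hzL

/-- **The binder `CGLSHeegnerClassNonvanishing` from the CGS binder and Cornut–Vatsal non-vanishing alone.**
Given `CGSHowardDivisibilityPLocalized` (which supplies `Module.Finite Λ 𝔖` and `finrank_Λ 𝔖 = 1` under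
`Thm413Hypotheses`) and the bare non-vanishing `stabilizedHeegnerModule D C ≠ ⊥` on every frame, all three conjuncts
of `CGLSHeegnerClassNonvanishing` hold: torsion-freeness is `noZeroSMulDivisors_of_noPTorsion`
(`Thm413Hypotheses.noPTorsion`, `.topGenerator`), the torsion quotient is rank–nullity. A Selmer-dual pin to feed the
CGS binder exists by `nonempty_selmerDualData_holds`.
[cite: CastellaGrossiLeeSkinner2022, Thm. 4.1.1 and Rem. 4.1.4 (κ₁^{Hg} ≠ 0 by Cornut–Vatsal; same Λ-line as κ_∞)]
[cite: CastellaGrossiSkinner2025, Thm. 6.5.2 (Λ-rank one of 𝔖 at any class number)] -/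
theorem cglsHeegnerClassNonvanishing_of_cgs_of_forall_ne_bot (hCGS : CGSHowardDivisibilityPLocalized)
    (hNV : ∀ (N : ℕ) [NeZero N] (W : WeierstrassCurve ℚ) [W.IsGloballyMinimal] (K : Type) [Field K] [NumberField K]
      (p : ℕ) [Fact p.Prime] (κ : ZpExtension K p) (γ : Field.absoluteGaloisGroup K)
      (jbar : AlgebraicClosure K →+* ℂ),
      CastellaGrossiLeeSkinner2022.Thm413Hypotheses N W K p κ γ →
      ∀ (D : (W.baseChange K).LambdaAdicSelmerData κ γ)
        (C : CastellaGrossiLeeSkinner2022.StabilizedHeegnerData N W K κ jbar),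
        CastellaGrossiLeeSkinner2022.stabilizedHeegnerModule D C ≠ ⊥) :
    CGLSHeegnerClassNonvanishing := by
  intro N _ W _ K _ _ p _ κ γ jbar hyp D C
  haveI : W.IsElliptic := hyp.isElliptic
  obtain ⟨X⟩ := (W.baseChange K).nonempty_selmerDualData_holds (κ := κ) γ hyp.topGenerator
  obtain ⟨⟨hfin, h1⟩, -⟩ := hCGS N W K p κ γ jbar hyp D C X
  haveI := hfin
  have hne := hNV N W K p κ γ jbar hyp D C
  obtain ⟨htf, htor⟩ := noZeroSMulDivisors_and_isTorsion_quotient_of_finrank_eq_one D hyp.topGenerator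
    hyp.noPTorsion h1 hne
  exact ⟨htf, hne, htor⟩

end Summit.BirchSwinnertonDyer.BirchSwinnertonDyer.Theorems.PrintX9Binders

end
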